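import Mathlib.Analysis.Calculus.MeanValue
import Mathlib.Analysis.Calculus.ContDiff.Basic
import Mathlib.Analysis.Calculus.ContDiff.Comp
import Mathlib.Analysis.Calculus.Deriv.Prod
import Mathlib.Analysis.Normed.Group.Bounded
import HarnessLib

/-!
# Uniform bounds and Taylor remainders in time for a smooth family over a compact set

A calculus brick (K3a of the notes) of the proof of the named fact
`Literature.Geometry.Riemannian.BarHanke2023_thm27_umbilicNormalForm` (Bär–Hanke, *Boundary
conditions for scalar curvature*, §3, Thm. 27). In the proofs of Props. 23 and 26 Bär–Hanke use
throughout that, by compactness ("the constant is independent of `δ`, `t`, `ξ`, `s`, `C`",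
p. 12), the slice metrics `g_t` read in charts, together with their derivatives, are uniformly
bounded and `g_t − g₀ − t ġ₀ = O(t²)`, `ġ_t − ġ₀ = O(t)` uniformly ((18)–(21)). This file proves
the underlying calculus statement:

* `exists_uniform_time_bounds` — for `F : V → ℝ → W` with `(y, s) ↦ F y s` of class `C^∞` on
  `U × ℝ` (`U` open) and a compact `K ⊆ U` there is `B ≥ 1` with, for all `y ∈ K`, `|t| ≤ 1`:
  `‖F y t‖, ‖∂_t F‖, ‖∂²_t F‖ ≤ B`, `‖F y t − F y 0‖ ≤ B|t|`, `‖∂_tF y t − ∂_tF y 0‖ ≤ B|t|` and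
  `‖F y t − F y 0 − t ∂_tF y 0‖ ≤ B t²` (mean value theorem along `t`; the time derivatives are
  values of the continuous maps `DΦ(·)(0,1)`, `D(DΦ(·)(0,1))(·)(0,1)` on the compact set
  `K × [−1, 1]`).

Everything is proved; no definitions, no named facts (D-0026).

## References

* C. Bär, B. Hanke, *Boundary conditions for scalar curvature*, arXiv:2012.09127, §3, proof of
  Prop. 26, (18)–(21). [BarHanke2023]
-/

noncomputable section

open Set Filter Function Metric
open scoped Topology ContDiff

namespace Literature.Geometry.Riemannian

variable {V : Type*} [NormedAddCommGroup V] [NormedSpace ℝ V]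
  {W : Type*} [NormedAddCommGroup W] [NormedSpace ℝ W]

/-- The time derivative of a jointly smooth family is the partial derivative `DΦ(y,t)(0,1)` of the
uncurried map. [folklore] -/
theorem hasDerivAt_family_of_contDiffOn {F : V → ℝ → W} {U : Set V} (hU : IsOpen U)
    (hF : ContDiffOn ℝ ∞ (fun q : V × ℝ ↦ F q.1 q.2) (U ×ˢ univ)) {y : V} (hy : y ∈ U) (t : ℝ) :
    HasDerivAt (F y) (fderiv ℝ (fun q : V × ℝ ↦ F q.1 q.2) (y, t) ((0 : V), (1 : ℝ))) t := by
  have hq : ((y, t) : V × ℝ) ∈ U ×ˢ (univ : Set ℝ) := ⟨hy, mem_univ _⟩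
  have hd : HasFDerivAt (fun q : V × ℝ ↦ F q.1 q.2)
      (fderiv ℝ (fun q : V × ℝ ↦ F q.1 q.2) (y, t)) (y, t) :=
    ((hF.differentiableOn (by simp)).differentiableAt
      ((hU.prod isOpen_univ).mem_nhds hq)).hasFDerivAt
  have hc : HasDerivAt (fun s : ℝ ↦ ((y, s) : V × ℝ)) ((0 : V), (1 : ℝ)) t :=
    (hasDerivAt_const t y).prodMk (hasDerivAt_id t)
  exact hd.comp_hasDerivAt t hc

/-- **Uniform bounds and Taylor remainders in time over a compact set.** Let `F : V → ℝ → W` be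
such that `(y, s) ↦ F y s` is `C^∞` on `U × ℝ` with `U` open, and let `K ⊆ U` be compact. Then
there is `B ≥ 1` such that for all `y ∈ K` and `|t| ≤ 1`: `‖F y t‖ ≤ B`, `‖∂_t F y t‖ ≤ B`,
`‖∂²_t F y t‖ ≤ B`, `‖F y t − F y 0‖ ≤ B |t|`, `‖∂_t F y t − ∂_t F y 0‖ ≤ B |t|`,
`‖F y t − F y 0 − t ∂_t F y 0‖ ≤ B t²`. [cite: BarHanke2023, §3, proof of Prop. 26, (18)–(21)] -/
theorem exists_uniform_time_bounds {F : V → ℝ → W} {U K : Set V} (hU : IsOpen U)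
    (hK : IsCompact K) (hKU : K ⊆ U)
    (hF : ContDiffOn ℝ ∞ (fun q : V × ℝ ↦ F q.1 q.2) (U ×ˢ univ)) :
    ∃ B : ℝ, 1 ≤ B ∧ ∀ y ∈ K, ∀ t ∈ Icc (-1 : ℝ) 1,
      ‖F y t‖ ≤ B ∧ ‖deriv (F y) t‖ ≤ B ∧ ‖deriv (deriv (F y)) t‖ ≤ B ∧
      ‖F y t - F y 0‖ ≤ B * |t| ∧ ‖deriv (F y) t - deriv (F y) 0‖ ≤ B * |t| ∧
      ‖F y t - F y 0 - t • deriv (F y) 0‖ ≤ B * t ^ 2 := by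
  -- the uncurried map and its time derivatives
  set Φ : V × ℝ → W := fun q ↦ F q.1 q.2 with hΦ
  have hUo : IsOpen (U ×ˢ (univ : Set ℝ)) := hU.prod isOpen_univ
  set Φ₁ : V × ℝ → W := fun q ↦ fderiv ℝ Φ q ((0 : V), (1 : ℝ)) with hΦ₁
  have hΦ₁s : ContDiffOn ℝ ∞ Φ₁ (U ×ˢ univ) :=
    (hF.fderiv_of_isOpen (m := ∞) hUo le_rfl).clm_apply contDiffOn_const
  have hd₁ : ∀ y ∈ U, ∀ t, HasDerivAt (F y) (Φ₁ (y, t)) t := fun y hy t ↦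
    hasDerivAt_family_of_contDiffOn hU hF hy t
  have hderiv₁ : ∀ y ∈ U, deriv (F y) = fun t ↦ Φ₁ (y, t) := fun y hy ↦
    funext fun t ↦ (hd₁ y hy t).deriv
  set Φ₂ : V × ℝ → W := fun q ↦ fderiv ℝ Φ₁ q ((0 : V), (1 : ℝ)) with hΦ₂
  have hΦ₁F : ContDiffOn ℝ ∞ (fun q : V × ℝ ↦ (fun y t ↦ Φ₁ (y, t)) q.1 q.2) (U ×ˢ univ) := hΦ₁s
  have hΦ₂s : ContDiffOn ℝ ∞ Φ₂ (U ×ˢ univ) :=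
    (hΦ₁s.fderiv_of_isOpen (m := ∞) hUo le_rfl).clm_apply contDiffOn_const
  have hd₂ : ∀ y ∈ U, ∀ t, HasDerivAt (deriv (F y)) (Φ₂ (y, t)) t := fun y hy t ↦ by
    rw [hderiv₁ y hy]
    exact hasDerivAt_family_of_contDiffOn (F := fun y t ↦ Φ₁ (y, t)) hU hΦ₁F hy t
  have hderiv₂ : ∀ y ∈ U, deriv (deriv (F y)) = fun t ↦ Φ₂ (y, t) := fun y hy ↦
    funext fun t ↦ (hd₂ y hy t).deriv
  -- bounds on the compact set `K × [-1, 1]`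
  have hKc : IsCompact (K ×ˢ Icc (-1 : ℝ) 1) := hK.prod isCompact_Icc
  have hKsub : K ×ˢ Icc (-1 : ℝ) 1 ⊆ U ×ˢ univ := prod_mono hKU (subset_univ _)
  obtain ⟨B₀, hB₀⟩ := hKc.exists_bound_of_continuousOn (hF.continuousOn.mono hKsub)
  obtain ⟨B₁, hB₁⟩ := hKc.exists_bound_of_continuousOn (hΦ₁s.continuousOn.mono hKsub)
  obtain ⟨B₂, hB₂⟩ := hKc.exists_bound_of_continuousOn (hΦ₂s.continuousOn.mono hKsub)
  set B : ℝ := max (max 1 B₀) (max B₁ B₂) with hB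
  have h1B : 1 ≤ B := (le_max_left _ _).trans (le_max_left _ _)
  have hB₀B : B₀ ≤ B := (le_max_right _ _).trans (le_max_left _ _)
  have hB₁B : B₁ ≤ B := (le_max_left _ _).trans (le_max_right _ _)
  have hB₂B : B₂ ≤ B := (le_max_right _ _).trans (le_max_right _ _)
  have hBnn : 0 ≤ B := zero_le_one.trans h1B
  refine ⟨B, h1B, fun y hy t ht ↦ ?_⟩
  have hyU : y ∈ U := hKU hy
  have h0 : (0 : ℝ) ∈ Icc (-1 : ℝ) 1 := ⟨by norm_num, by norm_num⟩
  -- pointwise bounds on `[-1, 1]`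
  have hb₀ : ∀ s ∈ Icc (-1 : ℝ) 1, ‖F y s‖ ≤ B := fun s hs ↦
    (hB₀ (y, s) ⟨hy, hs⟩).trans hB₀B
  have hb₁ : ∀ s ∈ Icc (-1 : ℝ) 1, ‖deriv (F y) s‖ ≤ B := fun s hs ↦ by
    rw [hderiv₁ y hyU]
    exact (hB₁ (y, s) ⟨hy, hs⟩).trans hB₁B
  have hb₂ : ∀ s ∈ Icc (-1 : ℝ) 1, ‖deriv (deriv (F y)) s‖ ≤ B := fun s hs ↦ by
    rw [hderiv₂ y hyU]
    exact (hB₂ (y, s) ⟨hy, hs⟩).trans hB₂B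
  have hconv : Convex ℝ (Icc (-1 : ℝ) 1) := convex_Icc _ _
  -- the two Lipschitz bounds
  have hdiffF : ∀ s ∈ Icc (-1 : ℝ) 1, DifferentiableAt ℝ (F y) s := fun s _ ↦
    (hd₁ y hyU s).differentiableAt
  have hdiffF' : ∀ s ∈ Icc (-1 : ℝ) 1, DifferentiableAt ℝ (deriv (F y)) s := fun s _ ↦
    (hd₂ y hyU s).differentiableAt
  have hL₀ : ‖F y t - F y 0‖ ≤ B * |t| := by
    have h := hconv.norm_image_sub_le_of_norm_deriv_le hdiffF hb₁ h0 ht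
    simpa using h
  have hL₁ : ‖deriv (F y) t - deriv (F y) 0‖ ≤ B * |t| := by
    have h := hconv.norm_image_sub_le_of_norm_deriv_le hdiffF' hb₂ h0 ht
    simpa using h
  -- the Taylor remainder: `g(s) = F y s - F y 0 - s • ∂_tF y 0` on the segment `[0, t]`
  have hT : ‖F y t - F y 0 - t • deriv (F y) 0‖ ≤ B * t ^ 2 := by
    set g : ℝ → W := fun s ↦ F y s - F y 0 - s • deriv (F y) 0 with hg
    have hgd : ∀ s, HasDerivAt g (deriv (F y) s - deriv (F y) 0) s := fun s ↦ by
      have h1 := ((hd₁ y hyU s).sub_const (F y 0)).sub ((hasDerivAt_id s).smul_const (deriv (F y) 0))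
      simp only [one_smul] at h1
      rw [(hd₁ y hyU s).deriv]
      exact h1
    have hseg : uIcc (0 : ℝ) t ⊆ Icc (-1 : ℝ) 1 := uIcc_subset_Icc h0 ht
    have hbound : ∀ s ∈ uIcc (0 : ℝ) t, ‖deriv g s‖ ≤ B * |t| := fun s hs ↦ by
      rw [(hgd s).deriv]
      have h := hconv.norm_image_sub_le_of_norm_deriv_le hdiffF' hb₂ h0 (hseg hs)
      have hst : |s| ≤ |t| := by
        rcases le_total 0 t with h0t | ht0
        · rw [uIcc_of_le h0t] at hs
          rw [abs_of_nonneg hs.1, abs_of_nonneg h0t]; exact hs.2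
        · rw [uIcc_of_ge ht0] at hs
          rw [abs_of_nonpos hs.2, abs_of_nonpos ht0]; linarith [hs.1]
      calc ‖deriv (F y) s - deriv (F y) 0‖ ≤ B * ‖s - 0‖ := h
        _ = B * |s| := by simp
        _ ≤ B * |t| := by gcongr
    have h := (convex_uIcc (0 : ℝ) t).norm_image_sub_le_of_norm_deriv_le
      (fun s _ ↦ (hgd s).differentiableAt) hbound left_mem_uIcc right_mem_uIcc
    have hg0 : g 0 = 0 := by simp [hg]
    rw [hg0, sub_zero] at h
    calc ‖F y t - F y 0 - t • deriv (F y) 0‖ = ‖g t‖ := rfl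
      _ ≤ B * |t| * ‖t - 0‖ := h
      _ = B * t ^ 2 := by rw [sub_zero, Real.norm_eq_abs, mul_assoc, ← sq, sq_abs]
  exact ⟨hb₀ t ht, hb₁ t ht, hb₂ t ht, hL₀, hL₁, hT⟩

end Literature.Geometry.Riemannian

end
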